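import Mathlib

/-!
# NE9LatticeExpSums — the two LATTICE SUMS (S) of the kernel species, PROVED on ℤ^d with explicit constants:
# `Σ_p e^{−δ·dist(p₀,p)} ≤ c₀(δ,d)` and `Σ_q dist(p,q)^m·e^{−δ·dist(p,q)} ≤ c₁(δ,d,m)` over ANY finite point family
# (cell `pub-balaban`, T4-DAG §2 node U3 ∕ §6 NE9; NE9 formalisation swarm LEAF PROVER 06, lineage leaf-06, generation 7; crew row (w24) of
# the row owner's list, CLAIMS.log l.10121: «the lattice sums (S) PROVED on ℤ⁴-boxes (c₀(δ₁), c₁(δ₁) explicit)»)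

HONEST FRAMING (T4-DAG PAGE 1).  Rung (B)+1 of the FINITE-VOLUME T⁴ programme — existence and uniqueness of the ε → 0 limit of
gauge-invariant observables on a FIXED finite torus; NOT infinite volume, NOT a mass gap, NOT the Clay problem.  NE9
(`T4OutputRate.NE9` ∧ `FadingMemory`) is a cell NEW ESTIMATE, NOT PRINTED, NOT discharged here («NE9 ⇐ the named binders»); spine
0/9; 0/18 skeleton leaves instantiated on Bałaban's objects.  HONEST DEPENDENCY (cell line, verbatim): continuum YM on T⁴ ⇐
BetaPertH ∧ nine spine estimates (0/9 proved); BetaPertH ⇐ (D1) ∧ (D4) ∧ CAP+tail; G-an2-4 gates asym, D1 and NE2/3/4.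
`FlowStep.BetaPertH`, (B), (B^μ) do not occur.  [I] = [Balaban1987RG1] (CMP **109**) is quoted for TYPES only (ABSOLUTE RULE: nothing
printed in the audited series is asserted).

THE POINT.  The owner's second species family of leaf S5 (`NE9Lemma1KernelSpecies`, the point-localized terms of [I] §4) displays in
`KerData.Admissible` two LATTICE-SUM binders (S): `sum0 : Σ_{p ∈ pts} exp(−(δ₁·ρd (p0 X) p)) ≤ c0` and
`sum1 : ∀ p ∈ pts, Σ_{q ∈ pts} (ρd p q)^m·exp(−(δ₁·ρd p q)) ≤ c1` — print's constants c₀(δ₁), c₁(δ₁) of [I] p. 286 (*"Summing over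
x, x₃ we get finally"*, with *"the decay rate is rather poor, δ₁ = O(M⁻¹)"*), never computed in print.  THIS FILE proves both shapes
for the cell's lattice model — points `Fin d → ℤ`, `ρd := dist` (Mathlib's sup metric on `Fin d → ℤ`, the cell's sup-metric convention
D-pv22.1 (i)) — over ANY finite point family and any base point, with EXPLICIT constants, by finite geometric series only
(kernel, 0 sorry, 0 def, Mathlib-only imports):
* §1 `sum_pow_natAbs_le`: `Σ_{n ∈ T} q^{|n|} ≤ 2∕(1 − q)` for every finite `T ⊂ ℤ`, `0 ≤ q < 1`;
* §2 `sum_prod_pow_natAbs_le`: `Σ_{x ∈ S} Π_i q^{|x i|} ≤ (2∕(1 − q))^d` for every finite `S ⊂ ℤ^d` (product over a coordinate box);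
  `exp_neg_mul_norm_le_prod`: `e^{−δ‖x‖_∞} ≤ Π_i e^{−(δ∕d)|x i|}` (`Σ_i |x i| ≤ d·‖x‖_∞`);
* §3 **`sum_exp_neg_dist_le`**: `Σ_{p ∈ S} e^{−δ·dist(p₀,p)} ≤ c₀(δ,d) := (2∕(1 − e^{−δ∕d}))^d` (δ > 0, d ≥ 1) — the `sum0` SHAPE;
* §4 `pow_mul_exp_neg_le`: `t^m·e^{−a t} ≤ (m∕(a·e))^m` (t ≥ 0, a > 0), and **`sum_pow_mul_exp_neg_dist_le`**:
  `Σ_{q ∈ S} dist(p,q)^m·e^{−δ·dist(p,q)} ≤ c₁(δ,d,m) := (2m∕(e·δ))^m·(2∕(1 − e^{−δ∕(2d)}))^d` — the `sum1` SHAPE;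
* §5 polynomial envelopes in print's letter δ₁ = O(M⁻¹): `2∕(1 − e^{−u}) ≤ 2(1 + u)∕u`, hence `c₀ ≤ (2(d + δ)∕δ)^d`,
  `c₁ ≤ (2m∕(eδ))^m·(2(2d + δ)∕δ)^d`; d = 4 read-out.
DISGUISE TEST: lattice arithmetic; no term, no activity, no history — not NE9.  The identification `Pt := Fin 4 → ℤ`, `ρd := dist`,
`pts := T₁^{(j)} ∩ □̃⁴` with Bałaban's unit lattice is O1-side; (K) and (G) of `KerData.Admissible` stay displayed.

References (TYPES only): [Balaban1987RG1] T. Bałaban, *Renormalization group approach to lattice gauge field theories. I*, Commun.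
Math. Phys. **109** (1987) 249–301, (4.21)–(4.22) pp. 285–286 (the sums over x, x₃ ∈ T₁^{(j)} ∩ □̃⁴ and the constants c₀(δ₁),
c₁(δ₁)).  Summits-side NEW work (LEAN PLACEMENT RULE); Mathlib only; modifies nothing; 0 sorry.  Value = two displayed binders of the
kernel species made kernel arithmetic with explicit constants, NOT summit progress.
-/

noncomputable section

namespace Summit.QuantumFields.BalabanUV.T4Continuum.NE9LatticeExpSums

open scoped BigOperators
open Finset Metric

/-! ## §1 One-dimensional two-sided geometric sums over a finite set of integers -/

/-- For `0 ≤ q < 1` and a finite set `T` of NONNEGATIVE integers, `Σ_{n ∈ T} q^{|n|} ≤ (1 − q)⁻¹` (injection `n ↦ |n|` into ℕ and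
the geometric series). [folklore] -/
theorem sum_pow_natAbs_le_of_nonneg (T : Finset ℤ) (hT : ∀ n ∈ T, 0 ≤ n) {q : ℝ} (hq0 : 0 ≤ q) (hq1 : q < 1) :
    ∑ n ∈ T, q ^ n.natAbs ≤ (1 - q)⁻¹ := by
  have hinj : Set.InjOn Int.natAbs (T : Set ℤ) := fun a ha b hb h =>
    Int.natAbs_inj_of_nonneg_of_nonneg (hT a ha) (hT b hb) |>.mp h
  rw [← Finset.sum_image (f := fun k : ℕ => q ^ k) hinj, ← tsum_geometric_of_lt_one hq0 hq1]
  exact Summable.sum_le_tsum _ (fun k _ => pow_nonneg hq0 k) (summable_geometric_of_lt_one hq0 hq1)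

/-- For `0 ≤ q < 1` and a finite set `T` of NONPOSITIVE integers, `Σ_{n ∈ T} q^{|n|} ≤ (1 − q)⁻¹`. [folklore] -/
theorem sum_pow_natAbs_le_of_nonpos (T : Finset ℤ) (hT : ∀ n ∈ T, n ≤ 0) {q : ℝ} (hq0 : 0 ≤ q) (hq1 : q < 1) :
    ∑ n ∈ T, q ^ n.natAbs ≤ (1 - q)⁻¹ := by
  have hinj : Set.InjOn Int.natAbs (T : Set ℤ) := fun a ha b hb h =>
    Int.natAbs_inj_of_nonpos_of_nonpos (hT a ha) (hT b hb) |>.mp h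
  rw [← Finset.sum_image (f := fun k : ℕ => q ^ k) hinj, ← tsum_geometric_of_lt_one hq0 hq1]
  exact Summable.sum_le_tsum _ (fun k _ => pow_nonneg hq0 k) (summable_geometric_of_lt_one hq0 hq1)

/-- **TWO-SIDED GEOMETRIC SUM**: for `0 ≤ q < 1` and EVERY finite `T ⊂ ℤ`, `Σ_{n ∈ T} q^{|n|} ≤ 2∕(1 − q)` (nonnegative and negative
parts separately). [folklore] -/
theorem sum_pow_natAbs_le (T : Finset ℤ) {q : ℝ} (hq0 : 0 ≤ q) (hq1 : q < 1) :
    ∑ n ∈ T, q ^ n.natAbs ≤ 2 / (1 - q) := by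
  rw [← Finset.sum_filter_add_sum_filter_not T (fun n : ℤ => 0 ≤ n)]
  have h1 := sum_pow_natAbs_le_of_nonneg (T.filter fun n : ℤ => 0 ≤ n) (fun n hn => (Finset.mem_filter.1 hn).2) hq0 hq1
  have h2 := sum_pow_natAbs_le_of_nonpos (T.filter fun n : ℤ => ¬ 0 ≤ n)
    (fun n hn => (not_le.mp (Finset.mem_filter.1 hn).2).le) hq0 hq1
  have : 2 / (1 - q) = (1 - q)⁻¹ + (1 - q)⁻¹ := by rw [div_eq_mul_inv]; ring
  rw [this]
  exact add_le_add h1 h2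

/-! ## §2 Boxes of `ℤ^d`: the product structure and the sup-metric comparison -/

variable {d : ℕ}

/-- Every finite `S ⊂ ℤ^d` lies in the coordinate box `T^d`, `T` := the set of all coordinate values occurring in `S`. [folklore] -/
theorem subset_piFinset_coords (S : Finset (Fin d → ℤ)) :
    S ⊆ Fintype.piFinset fun _ : Fin d => Finset.univ.biUnion fun i => S.image fun x => x i := by
  intro x hx
  rw [Fintype.mem_piFinset]
  intro i
  exact Finset.mem_biUnion.2 ⟨i, Finset.mem_univ i, Finset.mem_image.2 ⟨x, hx, rfl⟩⟩

/-- **PRODUCT BOUND ON A BOX**: for `0 ≤ q < 1` and every finite `S ⊂ ℤ^d`, `Σ_{x ∈ S} Π_i q^{|x i|} ≤ (2∕(1 − q))^d` (enlarge `S` to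
its coordinate box, `Finset.sum_prod_piFinset`, §1 in each coordinate). [folklore] -/
theorem sum_prod_pow_natAbs_le (S : Finset (Fin d → ℤ)) {q : ℝ} (hq0 : 0 ≤ q) (hq1 : q < 1) :
    ∑ x ∈ S, ∏ i, q ^ (x i).natAbs ≤ (2 / (1 - q)) ^ d := by
  set T : Finset ℤ := Finset.univ.biUnion fun i => S.image fun x => x i with hT
  calc ∑ x ∈ S, ∏ i, q ^ (x i).natAbs
      ≤ ∑ x ∈ Fintype.piFinset (fun _ : Fin d => T), ∏ i, q ^ (x i).natAbs :=
        Finset.sum_le_sum_of_subset_of_nonneg (subset_piFinset_coords S)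
          (fun x _ _ => Finset.prod_nonneg fun i _ => pow_nonneg hq0 _)
    _ = ∏ _i : Fin d, ∑ n ∈ T, q ^ n.natAbs := Finset.sum_prod_piFinset T (fun _ n => q ^ n.natAbs)
    _ ≤ ∏ _i : Fin d, (2 / (1 - q)) :=
        Finset.prod_le_prod (fun i _ => Finset.sum_nonneg fun n _ => pow_nonneg hq0 _)
          (fun i _ => sum_pow_natAbs_le T hq0 hq1)
    _ = (2 / (1 - q)) ^ d := by rw [Finset.prod_const, Finset.card_univ, Fintype.card_fin]

/-- The ℓ¹-mass of a lattice vector is at most `d` times its sup norm: `Σ_i |x i| ≤ d·‖x‖`. [folklore] -/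
theorem sum_abs_le_card_mul_norm (x : Fin d → ℤ) : ∑ i, |((x i : ℤ) : ℝ)| ≤ d * ‖x‖ := by
  calc ∑ i, |((x i : ℤ) : ℝ)| = ∑ i, ‖x i‖ := by simp_rw [Int.norm_eq_abs]
    _ ≤ ∑ _i : Fin d, ‖x‖ := Finset.sum_le_sum fun i _ => norm_le_pi_norm x i
    _ = d * ‖x‖ := by rw [Finset.sum_const, Finset.card_univ, Fintype.card_fin, nsmul_eq_mul]

/-- **SUP-METRIC COMPARISON**: for `δ ≥ 0` and `d ≥ 1`, `e^{−δ‖x‖_∞} ≤ Π_i (e^{−δ∕d})^{|x i|}`. [folklore] -/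
theorem exp_neg_mul_norm_le_prod (hd : 0 < d) {δ : ℝ} (hδ : 0 ≤ δ) (x : Fin d → ℤ) :
    Real.exp (-(δ * ‖x‖)) ≤ ∏ i, Real.exp (-(δ / d)) ^ (x i).natAbs := by
  have hd' : (0 : ℝ) < d := by exact_mod_cast hd
  have hprod : ∏ i, Real.exp (-(δ / d)) ^ (x i).natAbs = Real.exp (-(δ / d) * ∑ i, |((x i : ℤ) : ℝ)|) := by
    rw [Finset.mul_sum, Real.exp_sum]
    refine Finset.prod_congr rfl fun i _ => ?_
    rw [← Real.exp_nat_mul, Nat.cast_natAbs, Int.cast_abs]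
    ring_nf
  rw [hprod]
  apply Real.exp_le_exp.2
  have h := sum_abs_le_card_mul_norm x
  have h1 : δ / d * ∑ i, |((x i : ℤ) : ℝ)| ≤ δ / d * (d * ‖x‖) := mul_le_mul_of_nonneg_left h (div_nonneg hδ hd'.le)
  have h2 : δ / d * (d * ‖x‖) = δ * ‖x‖ := by field_simp
  linarith

/-! ## §3 The first lattice sum (S): `Σ_p e^{−δ·dist(p₀,p)}` over any finite point family -/

/-- **THE LATTICE SUM `sum0` WITH AN EXPLICIT CONSTANT (kernel).**  For `d ≥ 1`, `δ > 0`, EVERY finite family `S ⊂ ℤ^d` of lattice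
points and every base point `p₀`: `Σ_{p ∈ S} e^{−δ·dist(p₀,p)} ≤ c₀(δ,d) := (2∕(1 − e^{−δ∕d}))^d` (sup metric; translate by `p₀`,
compare with the coordinate product, §2).  Print: [I] p. 286, the sum over x ∈ T₁^{(j)} ∩ □̃⁴ of exp(−δ₁|x − x₀|), constant c₀(δ₁)
— here S-free and box-free. [cite: Balaban1987RG1, (4.21)-(4.22) pp.285-286] -/
theorem sum_exp_neg_dist_le (hd : 0 < d) {δ : ℝ} (hδ : 0 < δ) (S : Finset (Fin d → ℤ)) (p₀ : Fin d → ℤ) :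
    ∑ p ∈ S, Real.exp (-(δ * dist p₀ p)) ≤ (2 / (1 - Real.exp (-(δ / d)))) ^ d := by
  have hq0 : 0 ≤ Real.exp (-(δ / d)) := (Real.exp_pos _).le
  have hq1 : Real.exp (-(δ / d)) < 1 := by
    rw [Real.exp_lt_one_iff, neg_lt_zero]
    exact div_pos hδ (by exact_mod_cast hd)
  -- translate: p ↦ p − p₀ is injective
  have hinj : Set.InjOn (fun p : Fin d → ℤ => p - p₀) (S : Set (Fin d → ℤ)) := fun a _ b _ h => sub_left_injective h
  calc ∑ p ∈ S, Real.exp (-(δ * dist p₀ p))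
      ≤ ∑ p ∈ S, ∏ i, Real.exp (-(δ / d)) ^ ((p - p₀) i).natAbs := by
        refine Finset.sum_le_sum fun p _ => ?_
        rw [dist_comm, dist_eq_norm]
        exact exp_neg_mul_norm_le_prod hd hδ.le (p - p₀)
    _ = ∑ x ∈ S.image (fun p => p - p₀), ∏ i, Real.exp (-(δ / d)) ^ (x i).natAbs :=
        (Finset.sum_image (f := fun x : Fin d → ℤ => ∏ i, Real.exp (-(δ / d)) ^ (x i).natAbs) hinj).symm
    _ ≤ (2 / (1 - Real.exp (-(δ / d)))) ^ d := sum_prod_pow_natAbs_le _ hq0 hq1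

/-! ## §4 Moments: `t^m e^{−at} ≤ (m∕(ae))^m` and the second lattice sum (S) -/

/-- **POLYNOMIAL-TIMES-EXPONENTIAL ENVELOPE**: for `t ≥ 0`, `a > 0` and every `m : ℕ`, `t^m·e^{−a t} ≤ (m∕(a·e))^m` (equality at
`t = m∕a`; from `1 + u ≤ e^u` at `u = at∕m − 1`; for `m = 0` both sides read `e^{−at} ≤ 1`). [folklore] -/
theorem pow_mul_exp_neg_le (m : ℕ) {a t : ℝ} (ha : 0 < a) (ht : 0 ≤ t) :
    t ^ m * Real.exp (-(a * t)) ≤ (m / (a * Real.exp 1)) ^ m := by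
  rcases Nat.eq_zero_or_pos m with rfl | hm
  · simp only [pow_zero, one_mul, Nat.cast_zero, zero_div]
    rw [Real.exp_le_one_iff]; nlinarith
  have hm' : (0 : ℝ) < m := by exact_mod_cast hm
  -- u := a t / m;  u ≤ e^{u − 1}, i.e. (a e t / m) ≤ e^{a t / m}
  have hu : a * t / m * Real.exp 1 ≤ Real.exp (a * t / m) := by
    have h := Real.add_one_le_exp (a * t / m - 1)
    rw [sub_add_cancel, Real.exp_sub] at h
    rwa [le_div_iff₀ (Real.exp_pos 1)] at h
  have h0 : 0 ≤ a * t / m * Real.exp 1 := by positivity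
  -- raise to the m-th power: (a e t / m)^m ≤ e^{a t}
  have hpow : (a * t / m * Real.exp 1) ^ m ≤ Real.exp (a * t) := by
    calc (a * t / m * Real.exp 1) ^ m ≤ Real.exp (a * t / m) ^ m := pow_le_pow_left₀ h0 hu m
      _ = Real.exp (a * t) := by rw [← Real.exp_nat_mul]; congr 1; field_simp
  -- unfold: t^m (a e / m)^m ≤ e^{a t}
  have hc : 0 < a * Real.exp 1 / m := by positivity
  have hsplit : (a * t / m * Real.exp 1) ^ m = t ^ m * (a * Real.exp 1 / m) ^ m := by
    rw [← mul_pow]; congr 1; ring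
  rw [hsplit] at hpow
  have hcm : 0 < (a * Real.exp 1 / m) ^ m := pow_pos hc m
  calc t ^ m * Real.exp (-(a * t)) = t ^ m * (a * Real.exp 1 / m) ^ m * ((a * Real.exp 1 / m) ^ m)⁻¹ * Real.exp (-(a * t)) := by
        field_simp
    _ ≤ Real.exp (a * t) * ((a * Real.exp 1 / m) ^ m)⁻¹ * Real.exp (-(a * t)) := by
        gcongr
    _ = (m / (a * Real.exp 1)) ^ m := by
        rw [mul_comm (Real.exp (a * t)), mul_assoc, ← Real.exp_add, add_neg_cancel, Real.exp_zero, mul_one, ← inv_pow,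
          inv_div]

/-- **THE LATTICE SUM `sum1` WITH AN EXPLICIT CONSTANT (kernel).**  For `d ≥ 1`, `δ > 0`, every `m : ℕ`, EVERY finite family
`S ⊂ ℤ^d` and every point `p`: `Σ_{q ∈ S} dist(p,q)^m·e^{−δ·dist(p,q)} ≤ c₁(δ,d,m) := (2m∕(e·δ))^m · (2∕(1 − e^{−δ∕(2d)}))^d`
(split `e^{−δ·dist} = e^{−(δ∕2)dist}·e^{−(δ∕2)dist}`, §4's envelope on the first factor at rate δ∕2, §3 at rate δ∕2 on the rest).
Print: [I] p. 286, the sum over x₃ of |x₃ − x|^m exp(−δ₁|x₃ − x|) (m = 1 for (4.21), m = 2 for (4.30)), constant c₁(δ₁).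
[cite: Balaban1987RG1, (4.21)-(4.22) pp.285-286] -/
theorem sum_pow_mul_exp_neg_dist_le (hd : 0 < d) {δ : ℝ} (hδ : 0 < δ) (m : ℕ) (S : Finset (Fin d → ℤ)) (p : Fin d → ℤ) :
    ∑ q ∈ S, dist p q ^ m * Real.exp (-(δ * dist p q)) ≤
      (2 * m / (Real.exp 1 * δ)) ^ m * (2 / (1 - Real.exp (-(δ / 2 / d)))) ^ d := by
  have hδ2 : 0 < δ / 2 := by positivity
  have hK : ∀ q, dist p q ^ m * Real.exp (-(δ * dist p q)) ≤
      (2 * m / (Real.exp 1 * δ)) ^ m * Real.exp (-(δ / 2 * dist p q)) := by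
    intro q
    have h := pow_mul_exp_neg_le m hδ2 (dist_nonneg (x := p) (y := q))
    have hsplit : Real.exp (-(δ * dist p q)) = Real.exp (-(δ / 2 * dist p q)) * Real.exp (-(δ / 2 * dist p q)) := by
      rw [← Real.exp_add]; ring_nf
    have hconst : ((m : ℝ) / (δ / 2 * Real.exp 1)) ^ m = (2 * m / (Real.exp 1 * δ)) ^ m := by
      congr 1; field_simp
    rw [hsplit, ← mul_assoc, ← hconst]
    exact mul_le_mul_of_nonneg_right h (Real.exp_pos _).le
  calc ∑ q ∈ S, dist p q ^ m * Real.exp (-(δ * dist p q))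
      ≤ ∑ q ∈ S, (2 * m / (Real.exp 1 * δ)) ^ m * Real.exp (-(δ / 2 * dist p q)) := Finset.sum_le_sum fun q _ => hK q
    _ = (2 * m / (Real.exp 1 * δ)) ^ m * ∑ q ∈ S, Real.exp (-(δ / 2 * dist p q)) := by rw [Finset.mul_sum]
    _ ≤ (2 * m / (Real.exp 1 * δ)) ^ m * (2 / (1 - Real.exp (-(δ / 2 / d)))) ^ d :=
        mul_le_mul_of_nonneg_left (sum_exp_neg_dist_le hd hδ2 S p) (by positivity)

/-! ## §5 Polynomial envelopes of the constants in print's letter `δ₁ = O(M⁻¹)` -/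

/-- `2∕(1 − e^{−u}) ≤ 2(1 + u)∕u` for `u > 0` (from `1 + u ≤ e^u`: `1 − e^{−u} ≥ u∕(1 + u)`). [folklore] -/
theorem two_div_one_sub_exp_neg_le {u : ℝ} (hu : 0 < u) : 2 / (1 - Real.exp (-u)) ≤ 2 * (1 + u) / u := by
  have he : Real.exp (-u) ≤ 1 / (1 + u) := by
    rw [Real.exp_neg, one_div]
    exact inv_anti₀ (by linarith) (by linarith [Real.add_one_le_exp u])
  have hgap : u / (1 + u) ≤ 1 - Real.exp (-u) := by
    have : u / (1 + u) = 1 - 1 / (1 + u) := by field_simp; ring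
    rw [this]; linarith
  have hpos : 0 < u / (1 + u) := by positivity
  calc 2 / (1 - Real.exp (-u)) ≤ 2 / (u / (1 + u)) := div_le_div_of_nonneg_left (by norm_num) hpos hgap
    _ = 2 * (1 + u) / u := by field_simp

/-- `c₀(δ,d) ≤ (2(d + δ)∕δ)^d`: the first lattice sum with a POLYNOMIAL constant (print: δ₁ = O(M⁻¹), so c₀ = O(M⁴) on T⁴).
[cite: Balaban1987RG1, (4.22) p.286] -/
theorem sum_exp_neg_dist_le_poly (hd : 0 < d) {δ : ℝ} (hδ : 0 < δ) (S : Finset (Fin d → ℤ)) (p₀ : Fin d → ℤ) :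
    ∑ p ∈ S, Real.exp (-(δ * dist p₀ p)) ≤ (2 * (d + δ) / δ) ^ d := by
  have hd' : (0 : ℝ) < d := by exact_mod_cast hd
  have hq1 : Real.exp (-(δ / d)) < 1 := by
    rw [Real.exp_lt_one_iff, neg_lt_zero]; exact div_pos hδ hd'
  refine (sum_exp_neg_dist_le hd hδ S p₀).trans
    (pow_le_pow_left₀ (div_nonneg (by norm_num) (sub_pos.mpr hq1).le) ?_ d)
  calc 2 / (1 - Real.exp (-(δ / d))) ≤ 2 * (1 + δ / d) / (δ / d) := two_div_one_sub_exp_neg_le (div_pos hδ hd')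
    _ = 2 * (d + δ) / δ := by field_simp

/-- `c₁(δ,d,m) ≤ (2m∕(eδ))^m·(2(2d + δ)∕δ)^d`: the second lattice sum with a POLYNOMIAL constant. [cite: Balaban1987RG1, (4.22) p.286] -/
theorem sum_pow_mul_exp_neg_dist_le_poly (hd : 0 < d) {δ : ℝ} (hδ : 0 < δ) (m : ℕ) (S : Finset (Fin d → ℤ))
    (p : Fin d → ℤ) :
    ∑ q ∈ S, dist p q ^ m * Real.exp (-(δ * dist p q)) ≤ (2 * m / (Real.exp 1 * δ)) ^ m * (2 * (2 * d + δ) / δ) ^ d := by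
  have hd' : (0 : ℝ) < d := by exact_mod_cast hd
  have hq1 : Real.exp (-(δ / 2 / d)) < 1 := by
    rw [Real.exp_lt_one_iff, neg_lt_zero]; positivity
  refine (sum_pow_mul_exp_neg_dist_le hd hδ m S p).trans (mul_le_mul_of_nonneg_left ?_ (by positivity))
  refine pow_le_pow_left₀ (div_nonneg (by norm_num) (sub_pos.mpr hq1).le) ?_ d
  calc 2 / (1 - Real.exp (-(δ / 2 / d))) ≤ 2 * (1 + δ / 2 / d) / (δ / 2 / d) :=
        two_div_one_sub_exp_neg_le (by positivity)
    _ = 2 * (2 * d + δ) / δ := by field_simp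

/-- **d = 4 READ-OUT** (the cell's torus dimension): over any finite family of points of ℤ⁴ and any base point,
`Σ_p e^{−δ·dist(p₀,p)} ≤ (2(4 + δ)∕δ)⁴` and `Σ_q dist(p,q)^m e^{−δ·dist(p,q)} ≤ (2m∕(eδ))^m·(2(8 + δ)∕δ)⁴`. [folklore] -/
theorem lattice_sums_four {δ : ℝ} (hδ : 0 < δ) (m : ℕ) (S : Finset (Fin 4 → ℤ)) (p₀ p : Fin 4 → ℤ) :
    ∑ q ∈ S, Real.exp (-(δ * dist p₀ q)) ≤ (2 * (4 + δ) / δ) ^ 4 ∧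
      ∑ q ∈ S, dist p q ^ m * Real.exp (-(δ * dist p q)) ≤ (2 * m / (Real.exp 1 * δ)) ^ m * (2 * (8 + δ) / δ) ^ 4 := by
  refine ⟨?_, ?_⟩
  · have h := sum_exp_neg_dist_le_poly (d := 4) (by norm_num) hδ S p₀
    norm_num at h ⊢; exact h
  · have h := sum_pow_mul_exp_neg_dist_le_poly (d := 4) (by norm_num) hδ m S p
    norm_num at h ⊢; exact h

end Summit.QuantumFields.BalabanUV.T4Continuum.NE9LatticeExpSums

end
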